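import Literature.Computability.QuantumComplexity.PPPostBQPPredicate
import Literature.Computability.QuantumComplexity.PPPostBQPScales
import HarnessLib

/-!
# `PP ⊆ PostBQP`, III: the scaled block predicates, their gaps, and the product test

Topic `Literature/Computability/QuantumComplexity`; third file of the series proving Aaronson's
`PP ⊆ PostBQP` (Proc. R. Soc. A 461 (2005), Thm. 4; plan in `PPPostBQPScales.lean`). Aaronson's
scan over the ratios `β/α = 2^i`, `i ∈ [-n, n]`, becomes here a family of **block predicates**,
one per scale `i = 0, …, J` (`J = m + 1`, `m = p |x|`), all evaluated inside ONE counting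
computation: block `i` reads a sign coin `s` and a body of `B = (m+3) + (m+1) + 1` coins
`yt wz u`, and returns `baseBit x yt ⊕ s` if `u = 0`, and `[wz↾i ≠ 0^i] ∧ (last bit of yt)` if
`u = 1` (`blockBit`). Its gap over the body,
`blockGap x i s = Σ_body (-1)^{blockBit} = 2^{m+3} · 2^{m+1-i} + (-1)^s · 2^{m+2} · G_x`
(`blockGap_eq`; the first summand counts the bodies with `u = 1`, `wz↾i = 0^i`, the second is
`2^{m+1}` copies of the base gap `2 G_x` of file II), satisfies
`2^i · blockGap x i s = 2^{m+2} (C + (-1)^s 2^i G_x)` with `C = 2^{m+2}` (`two_pow_mul_blockGap`) —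
exactly the pair of weights `(C ± 2^i G)` of the product test of file I, up to the positive factor
`2^{m+2-i}`. Consequently (`four_mul_minusW_le_plusW`, `four_mul_plusW_le_minusW`,
`plusW_pos`, `minusW_pos`): with `plusW = Π_{i ≤ J} blockGap(i, 0)²` and
`minusW = Π_{i ≤ J} blockGap(i, 1)²`, `4 · minusW ≤ plusW` and `plusW > 0` when `G_x > 0`
(`x ∈ L`), and symmetrically when `G_x < 0`.

Finally `qbits x i₀ ss l` evaluates the blocks `i₀, i₀ + 1, …` with signs `ss` on consecutive
bodies of `l`, and **the sign sums factorise** (`sum_prod_sgn_qbits`):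
`Σ_{bodies} Π_j (-1)^{qbits_j} = Π_j blockGap (i₀ + j) (ss_j)` — the identity behind the Born
weights of the post-selected outcomes of the quantum core (file V), whose final Hadamard layer
turns the computed bits into exactly this character sum.

## References

* S. Aaronson, *Quantum computing, postselection, and probabilistic polynomial-time*, Proc. R.
  Soc. A 461 (2005) 3473–3482, arXiv:quant-ph/0412187: Thm. 4 and its proof (the scales `2^i`).
-/

namespace Literature.Computability.QuantumComplexity

namespace PPPostBQP

open Finset Complexity _root_.Computability

variable (R : Language Bool) (p : Polynomial ℕ)

/-! ### The block predicate -/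

/-- The number of body coins of a block: `B = (m+3) + ((m+1) + 1)` (`yt`, `wz`, `u`). [folklore] -/
def bodyLen (n : ℕ) : ℕ := (p.eval n + 3) + ((p.eval n + 1) + 1)

/-- **The block predicate of scale `i`** on a sign coin `s` and a body `yt wz u`
(`|yt| = m+3`, `|wz| = m+1`): if `u = 0`, `baseBit x yt ⊕ s`; if `u = 1`, `1` iff the first `i`
coins of `wz` are not all `0` and the last coin of `yt` is `1`. Out-of-format bodies are read
through `List.take`/`List.drop`/`List.getD` (junk convention, never met).
[cite: Aaronson2005, Thm. 4 (proof: the ratios 2^i)] -/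
noncomputable def blockBit (x : List Bool) (i : ℕ) (s : Bool) (body : List Bool) : Bool :=
  if body.getD (2 * p.eval x.length + 4) false then
    ((body.drop (p.eval x.length + 3)).take i).any id && body.getD (p.eval x.length + 2) false
  else (baseBit R p x (body.take (p.eval x.length + 3)) ^^ s)

/-- **The gap of block `i`** with sign `s`: `Σ_{body ∈ {0,1}^B} (-1)^{blockBit x i s body}`.
[cite: Aaronson2005, Thm. 4 (proof)] -/
noncomputable def blockGap (x : List Bool) (i : ℕ) (s : Bool) : ℤ :=
  ∑ body : Fin (bodyLen p x.length) → Bool, sgn (blockBit R p x i s (List.ofFn body))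

variable {R p}

/-- `blockBit` on a well-formed body `yt ++ wz ++ [u]`, for `i ≤ m + 1`. [folklore] -/
theorem blockBit_append (x : List Bool) {i : ℕ} (hi : i ≤ p.eval x.length + 1) (s : Bool)
    (yt : Fin (p.eval x.length + 3) → Bool) (wz : Fin (p.eval x.length + 1) → Bool) (u : Bool) :
    blockBit R p x i s (List.ofFn yt ++ (List.ofFn wz ++ [u])) =
      if u then ((List.ofFn wz).take i).any id && (List.ofFn yt).getD (p.eval x.length + 2) false
      else (baseBit R p x (List.ofFn yt) ^^ s) := by
  have hy : (List.ofFn yt).length = p.eval x.length + 3 := List.length_ofFn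
  have hw : (List.ofFn wz).length = p.eval x.length + 1 := List.length_ofFn
  have hu : (List.ofFn yt ++ (List.ofFn wz ++ [u])).getD (2 * p.eval x.length + 4) false = u := by
    rw [List.getD_append_right _ _ _ _ (by omega), List.getD_append_right _ _ _ _ (by omega), hy, hw,
      show 2 * p.eval x.length + 4 - (p.eval x.length + 3) - (p.eval x.length + 1) = 0 by omega]
    rfl
  have hd : ((List.ofFn yt ++ (List.ofFn wz ++ [u])).drop (p.eval x.length + 3)).take i =
      (List.ofFn wz).take i := by
    rw [List.drop_left' hy, List.take_append_of_le_length (by omega)]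
  have hb : (List.ofFn yt ++ (List.ofFn wz ++ [u])).getD (p.eval x.length + 2) false =
      (List.ofFn yt).getD (p.eval x.length + 2) false :=
    List.getD_append _ _ _ _ (by omega)
  have ht : (List.ofFn yt ++ (List.ofFn wz ++ [u])).take (p.eval x.length + 3) = List.ofFn yt :=
    List.take_left' hy
  unfold blockBit
  rw [hu, hd, hb, ht]

/-- The last coin of `yt ++ [b]`, read by `getD`. [folklore] -/
theorem getD_ofFn_append_singleton {k : ℕ} (u : Fin k → Bool) (b : Bool) :
    (List.ofFn u ++ [b]).getD k false = b := by
  rw [List.getD_append_right _ _ _ _ (by simp), List.length_ofFn, Nat.sub_self]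
  rfl

/-- A list of bits has no `1` iff the function it lists is constantly `false`. [folklore] -/
theorem any_ofFn_eq_false_iff {k : ℕ} (w : Fin k → Bool) :
    (List.ofFn w).any id = false ↔ w = fun _ => false := by
  rw [List.any_eq_false]
  simp only [List.forall_mem_ofFn_iff, id]
  exact ⟨fun h => funext fun i => by simpa using h i, fun h i => by simp [h]⟩

/-- **Counting prefixes**: the number of `w ∈ {0,1}^k` whose first `i` bits are `0` is `2^{k-i}`
(as the sum of the indicator, for `i ≤ k`). [folklore] -/
theorem sum_ite_any_take : ∀ (k i : ℕ), i ≤ k →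
    ∑ w : Fin k → Bool, (if ((List.ofFn w).take i).any id then (0 : ℤ) else 1) = 2 ^ (k - i)
  | 0, i, hi => by
    obtain rfl : i = 0 := Nat.le_zero.1 hi
    simp
  | k + 1, i, hi => by
    rcases Nat.lt_or_eq_of_le hi with h | rfl
    · rw [sum_fin_succ]
      have hk : i ≤ k := Nat.lt_succ_iff.1 h
      have e : ∀ (u : Fin k → Bool) (b : Bool),
          ((List.ofFn (Fin.append u fun _ : Fin 1 => b)).take i).any id = ((List.ofFn u).take i).any id := by
        intro u b
        rw [List.ofFn_fin_append, ofFn_const_fin_one, List.take_append_of_le_length (by simpa using hk)]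
      simp_rw [e]
      simp only [sum_const, card_univ, Fintype.card_bool, nsmul_eq_mul, Nat.cast_ofNat]
      rw [← Finset.mul_sum, sum_ite_any_take k i hk, Nat.succ_sub hk, pow_succ]
      ring
    · have e : ∀ w : Fin (k + 1) → Bool, ((List.ofFn w).take (k + 1)).any id = (List.ofFn w).any id := by
        intro w; rw [List.take_of_length_le (by simp)]
      simp_rw [e, Nat.sub_self, pow_zero]
      have e2 : ∀ w : Fin (k + 1) → Bool, (if (List.ofFn w).any id then (0 : ℤ) else 1) =
          if w = fun _ => false then 1 else 0 := by
        intro w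
        by_cases hw : w = fun _ => false
        · rw [if_pos hw, (any_ofFn_eq_false_iff w).2 hw]; rfl
        · cases h : (List.ofFn w).any id
          · exact absurd ((any_ofFn_eq_false_iff w).1 h) hw
          · rw [if_neg hw]; rfl
      simp_rw [e2]
      rw [Finset.sum_ite_eq']
      simp

/-- **The gap of a block**, closed form: for `i ≤ m + 1`,
`blockGap x i s = 2^{m+3} · 2^{m+1-i} + 2^{m+2} · (-1)^s · G_x`.
[cite: Aaronson2005, Thm. 4 (proof)] -/
theorem blockGap_eq (x : List Bool) {i : ℕ} (hi : i ≤ p.eval x.length + 1) (s : Bool) :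
    blockGap R p x i s = 2 ^ (p.eval x.length + 3) * 2 ^ (p.eval x.length + 1 - i) +
      2 ^ (p.eval x.length + 2) * sgn s * gapG R p x := by
  unfold blockGap bodyLen
  rw [sum_fin_add]
  simp_rw [sum_fin_succ (p.eval x.length + 1), List.ofFn_fin_append, ofFn_const_fin_one,
    blockBit_append x hi]
  simp_rw [Fintype.sum_bool, Bool.false_eq_true, if_true, if_false]
  rw [Finset.sum_comm]
  simp_rw [Finset.sum_add_distrib]
  -- the `u = 1` half
  have h1 : ∀ wz : Fin (p.eval x.length + 1) → Bool,
      ∑ yt : Fin (p.eval x.length + 3) → Bool,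
        sgn (((List.ofFn wz).take i).any id && (List.ofFn yt).getD (p.eval x.length + 2) false) =
        if ((List.ofFn wz).take i).any id then 0 else 2 ^ (p.eval x.length + 3) := by
    intro wz
    split_ifs with h
    · simp_rw [h, Bool.true_and]
      rw [sum_fin_succ]
      simp_rw [List.ofFn_fin_append, ofFn_const_fin_one, getD_ofFn_append_singleton, sum_sgn, sum_const_zero]
    · have h' : ((List.ofFn wz).take i).any id = false := by simpa using h
      simp_rw [h', Bool.false_and, sgn_false, sum_const, card_univ, Fintype.card_fun, Fintype.card_bool,
        Fintype.card_fin]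
      simp
  -- the `u = 0` half
  have h0 : ∑ yt : Fin (p.eval x.length + 3) → Bool, sgn (baseBit R p x (List.ofFn yt) ^^ s) =
      sgn s * (2 * gapG R p x) := by
    simp_rw [sgn_xor, ← Finset.sum_mul, sum_sgn_baseBit]
    ring
  simp_rw [h1, h0]
  rw [sum_const, card_univ, Fintype.card_fun, Fintype.card_bool, Fintype.card_fin, nsmul_eq_mul]
  have h2 : ∑ wz : Fin (p.eval x.length + 1) → Bool,
      (if ((List.ofFn wz).take i).any id then (0 : ℤ) else 2 ^ (p.eval x.length + 3)) =
        2 ^ (p.eval x.length + 3) * 2 ^ (p.eval x.length + 1 - i) := by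
    rw [← sum_ite_any_take _ i hi, Finset.mul_sum]
    refine Finset.sum_congr rfl fun wz _ => ?_
    split_ifs <;> simp
  rw [h2, pow_succ, pow_succ]
  push_cast
  ring

/-- **The block gaps are the weights of the product test**: for `i ≤ m + 1`,
`2^i · blockGap x i s = 2^{m+2} · (2^{m+2} + (-1)^s · 2^i · G_x)`.
[cite: Aaronson2005, Thm. 4 (proof)] -/
theorem two_pow_mul_blockGap (x : List Bool) {i : ℕ} (hi : i ≤ p.eval x.length + 1) (s : Bool) :
    2 ^ i * blockGap R p x i s =
      2 ^ (p.eval x.length + 2) * (2 ^ (p.eval x.length + 2) + sgn s * 2 ^ i * gapG R p x) := by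
  rw [blockGap_eq x hi]
  obtain ⟨d, hd⟩ := Nat.exists_eq_add_of_le hi
  have e1 : (2 : ℤ) ^ (p.eval x.length + 3) = 2 ^ i * 2 ^ d * 4 := by
    rw [show p.eval x.length + 3 = (i + d) + 2 by omega, pow_add, pow_add]; norm_num
  have e2 : (2 : ℤ) ^ (p.eval x.length + 2) = 2 ^ i * 2 ^ d * 2 := by
    rw [show p.eval x.length + 2 = (i + d) + 1 by omega, pow_succ, pow_add]
  rw [show p.eval x.length + 1 - i = d by omega, e1, e2]
  ring

/-! ### The product test on the block gaps -/

section Test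

variable (R p)

/-- The `+` weight: `Π_{i ≤ m+1} blockGap(x, i, 0)²` (proportional to the Born weight of
"every block guesses `+`"). [cite: Aaronson2005, Thm. 4 (proof)] -/
noncomputable def plusW (x : List Bool) : ℝ :=
  ∏ i ∈ range (p.eval x.length + 2), ((blockGap R p x i false : ℤ) : ℝ) ^ 2

/-- The `-` weight: `Π_{i ≤ m+1} blockGap(x, i, 1)²`. [cite: Aaronson2005, Thm. 4 (proof)] -/
noncomputable def minusW (x : List Bool) : ℝ :=
  ∏ i ∈ range (p.eval x.length + 2), ((blockGap R p x i true : ℤ) : ℝ) ^ 2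

variable {R p}

/-- The squared block gap as a weighted square of `C ± 2^i G`. [folklore] -/
theorem blockGap_sq_eq (x : List Bool) {i : ℕ} (hi : i ≤ p.eval x.length + 1) (s : Bool) :
    ((blockGap R p x i s : ℤ) : ℝ) ^ 2 =
      ((2 : ℝ) ^ (p.eval x.length + 2) / 2 ^ i) ^ 2 *
        ((2 : ℝ) ^ (p.eval x.length + 2) + (sgn s : ℝ) * (2 ^ i * (gapG R p x : ℝ))) ^ 2 := by
  have h := two_pow_mul_blockGap (R := R) (p := p) x hi s
  have h' : (2 : ℝ) ^ i * (blockGap R p x i s : ℝ) =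
      2 ^ (p.eval x.length + 2) * (2 ^ (p.eval x.length + 2) + (sgn s : ℝ) * 2 ^ i * (gapG R p x : ℝ)) := by
    exact_mod_cast h
  have h2 : (2 : ℝ) ^ i ≠ 0 := pow_ne_zero _ two_ne_zero
  have hb : (blockGap R p x i s : ℝ) =
      2 ^ (p.eval x.length + 2) / 2 ^ i * (2 ^ (p.eval x.length + 2) + (sgn s : ℝ) * (2 ^ i * (gapG R p x : ℝ))) := by
    field_simp
    linarith [h']
  rw [hb, mul_pow]

/-- The size conditions of the product test hold: `0 < G ≤ 3C` and `C ≤ 3 · 2^{m+1} · G` for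
`C = 2^{m+2}` and `0 < G = |G_x| ≤ 2^{m+1} + 1`. [folklore] -/
theorem scale_conditions (x : List Bool) {G : ℝ} (hG1 : 1 ≤ G) (hG2 : G ≤ 2 ^ (p.eval x.length + 1) + 1) :
    G ≤ 3 * (2 : ℝ) ^ (p.eval x.length + 2) ∧
      (2 : ℝ) ^ (p.eval x.length + 2) ≤ 3 * 2 ^ (p.eval x.length + 1) * G := by
  have h1 : (1 : ℝ) ≤ 2 ^ (p.eval x.length + 1) := one_le_pow₀ (by norm_num)
  rw [pow_succ]
  constructor <;> nlinarith

/-- **The product test, member side**: if `G_x > 0` then `4 · minusW ≤ plusW`.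
[cite: Aaronson2005, Thm. 4 (proof)] -/
theorem four_mul_minusW_le_plusW {x : List Bool} (hG : 0 < gapG R p x) :
    4 * minusW R p x ≤ plusW R p x := by
  have hG1 : (1 : ℝ) ≤ gapG R p x := by exact_mod_cast hG
  have hGa : (gapG R p x : ℝ) ≤ 2 ^ (p.eval x.length + 1) + 1 := by
    have := (abs_le.1 (abs_gapG_le (R := R) (p := p) x)).2
    exact_mod_cast this
  obtain ⟨c1, c2⟩ := scale_conditions (p := p) x hG1 hGa
  unfold minusW plusW
  rw [Finset.prod_congr rfl fun i hi => blockGap_sq_eq x (Nat.lt_succ_iff.1 (mem_range.1 hi)) true,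
    Finset.prod_congr rfl fun i hi => blockGap_sq_eq x (Nat.lt_succ_iff.1 (mem_range.1 hi)) false]
  simp only [sgn_true, sgn_false, Int.cast_neg, Int.cast_one, neg_mul, one_mul, ← sub_eq_add_neg]
  exact four_mul_prod_mul_le (fun i => sq_nonneg _)
    (four_mul_prod_sq_sub_le (by positivity) (by linarith) c1 c2)

/-- **The product test, non-member side**: if `G_x < 0` then `4 · plusW ≤ minusW`.
[cite: Aaronson2005, Thm. 4 (proof)] -/
theorem four_mul_plusW_le_minusW {x : List Bool} (hG : gapG R p x < 0) :
    4 * plusW R p x ≤ minusW R p x := by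
  have hG1 : (1 : ℝ) ≤ -(gapG R p x : ℝ) := by
    have : (1 : ℤ) ≤ - gapG R p x := by omega
    exact_mod_cast this
  have hGa : -(gapG R p x : ℝ) ≤ 2 ^ (p.eval x.length + 1) + 1 := by
    have := (abs_le.1 (abs_gapG_le (R := R) (p := p) x)).1
    have : -gapG R p x ≤ 2 ^ (p.eval x.length + 1) + 1 := by linarith
    exact_mod_cast this
  obtain ⟨c1, c2⟩ := scale_conditions (p := p) x hG1 hGa
  unfold minusW plusW
  rw [Finset.prod_congr rfl fun i hi => blockGap_sq_eq x (Nat.lt_succ_iff.1 (mem_range.1 hi)) true,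
    Finset.prod_congr rfl fun i hi => blockGap_sq_eq x (Nat.lt_succ_iff.1 (mem_range.1 hi)) false]
  simp only [sgn_true, sgn_false, Int.cast_neg, Int.cast_one, neg_mul, one_mul, ← sub_eq_add_neg]
  exact four_mul_prod_mul_le (fun i => sq_nonneg _)
    (four_mul_prod_sq_add_le (by positivity) (by exact_mod_cast hG) c1 c2)

/-- The `+` weight is positive when `G_x > 0` (all factors `C + 2^i G > 0`). [folklore] -/
theorem plusW_pos {x : List Bool} (hG : 0 < gapG R p x) : 0 < plusW R p x := by
  unfold plusW
  refine prod_pos fun i hi => ?_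
  rw [blockGap_sq_eq x (Nat.lt_succ_iff.1 (mem_range.1 hi)) false]
  have : (0 : ℝ) < gapG R p x := by exact_mod_cast hG
  simp only [sgn_false, Int.cast_one, one_mul]
  positivity

/-- The `-` weight is positive when `G_x < 0` (all factors `C - 2^i G > 0`). [folklore] -/
theorem minusW_pos {x : List Bool} (hG : gapG R p x < 0) : 0 < minusW R p x := by
  unfold minusW
  refine prod_pos fun i hi => ?_
  rw [blockGap_sq_eq x (Nat.lt_succ_iff.1 (mem_range.1 hi)) true]
  have hG' : (gapG R p x : ℝ) < 0 := by exact_mod_cast hG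
  have : (0 : ℝ) < 2 ^ (p.eval x.length + 2) + (sgn true : ℝ) * (2 ^ i * (gapG R p x : ℝ)) := by
    simp only [sgn_true, Int.cast_neg, Int.cast_one, neg_mul, one_mul]
    nlinarith [pow_pos (two_pos : (0:ℝ) < 2) i, pow_pos (two_pos : (0:ℝ) < 2) (p.eval x.length + 2)]
  positivity

/-- Both weights are nonnegative. [folklore] -/
theorem plusW_nonneg (x : List Bool) : 0 ≤ plusW R p x := prod_nonneg fun _ _ => sq_nonneg _

/-- Both weights are nonnegative. [folklore] -/
theorem minusW_nonneg (x : List Bool) : 0 ≤ minusW R p x := prod_nonneg fun _ _ => sq_nonneg _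

end Test

/-! ### Consecutive blocks and the factorisation of the sign sums -/

section Blocks

variable (R p)

/-- The total length of `k` bodies, as an iterated sum (so that `{0,1}^{B + rest}` splits
definitionally). [folklore] -/
def bodiesLen (B : ℕ) : ℕ → ℕ
  | 0 => 0
  | k + 1 => B + bodiesLen B k

/-- **The computed bits**: blocks `i₀, i₀ + 1, …` with signs `ss`, evaluated on consecutive
bodies of `l` (body length `B = bodyLen p |x|`). [cite: Aaronson2005, Thm. 4 (proof)] -/
noncomputable def qbits (x : List Bool) : ℕ → List Bool → List Bool → List Bool
  | _, [], _ => []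
  | i, s :: ss, l => blockBit R p x i s (l.take (bodyLen p x.length)) ::
      qbits x (i + 1) ss (l.drop (bodyLen p x.length))

variable {R p}

/-- `bodiesLen B k = k · B`. [folklore] -/
theorem bodiesLen_eq (B : ℕ) : ∀ k, bodiesLen B k = k * B
  | 0 => by simp [bodiesLen]
  | k + 1 => by rw [bodiesLen, bodiesLen_eq B k]; ring

/-- One computed bit per sign. [folklore] -/
theorem length_qbits (x : List Bool) : ∀ (i : ℕ) (ss l : List Bool), (qbits R p x i ss l).length = ss.length
  | _, [], _ => rfl
  | i, s :: ss, l => by rw [qbits, List.length_cons, length_qbits x (i + 1) ss, List.length_cons]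

/-- Peeling the first body. [folklore] -/
theorem qbits_cons_append (x : List Bool) (i : ℕ) (s : Bool) (ss : List Bool) {u : List Bool}
    (hu : u.length = bodyLen p x.length) (l : List Bool) :
    qbits R p x i (s :: ss) (u ++ l) = blockBit R p x i s u :: qbits R p x (i + 1) ss l := by
  rw [qbits, ← hu, List.take_left, List.drop_left]

/-- **Factorisation of the sign sums**: summed over all bodies, the product of the signs of the
computed bits is the product of the block gaps (the blocks read pairwise disjoint coins).
[cite: Aaronson2005, Thm. 4 (proof)] -/
theorem sum_prod_sgn_qbits (x : List Bool) : ∀ (ss : List Bool) (i₀ : ℕ),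
    ∑ Y : Fin (bodiesLen (bodyLen p x.length) ss.length) → Bool,
        ((qbits R p x i₀ ss (List.ofFn Y)).map sgn).prod =
      ∏ j ∈ range ss.length, blockGap R p x (i₀ + j) (ss.getD j false)
  | [], i₀ => by simp [qbits, bodiesLen]
  | s :: ss, i₀ => by
    rw [List.length_cons, prod_range_succ', show bodiesLen (bodyLen p x.length) (ss.length + 1) =
      bodyLen p x.length + bodiesLen (bodyLen p x.length) ss.length from rfl, sum_fin_add]
    simp_rw [List.ofFn_fin_append, qbits_cons_append x i₀ s ss (List.length_ofFn (f := _)) (List.ofFn _),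
      List.map_cons, List.prod_cons, ← Finset.mul_sum, sum_prod_sgn_qbits x ss (i₀ + 1), ← Finset.sum_mul]
    simp only [List.getD_cons_zero, List.getD_cons_succ, Nat.add_zero, blockGap]
    rw [mul_comm]
    refine congrArg₂ (· * ·) (prod_congr rfl fun j _ => ?_) rfl
    rw [show i₀ + 1 + j = i₀ + (j + 1) by ring]

end Blocks

end PPPostBQP

end Literature.Computability.QuantumComplexity
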